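import Literature.Geometry.Riemannian.BakryEmeryHeatFlow
import Literature.Geometry.Lorentzian.CoordSurfaceBochner
import Literature.Geometry.Lorentzian.CurvatureNaturality
import HarnessLib

/-!
# The transgression identity of the Gauss–Bonnet integrand on a Riemannian surface

Let `(M, g)` be a smooth Riemannian surface (boundaryless model, `dim = 2`) and `f : M → ℝ`
smooth. Write `u = |∇f|²_g = g⁻¹(df, df)` (`PseudoRiemannianMetric.gradSq`), `L = Δ_g f`
(`dalembertian`), `⟨dφ, dχ⟩ = g⁻¹(dφ, dχ)` (`innerDual`) and `S` for the scalar curvature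
(`S = 2K`). Then at every point

  `½ S u² = ½ u Δu − ½ ⟨du, du⟩ − u ⟨dL, df⟩ + L ⟨du, df⟩ − L² u`

(`half_scalarCurvature_mul_gradSq_sq`). Away from the critical points of `f` this is the
exactness of the curvature form, `K dA = dω₁₂` for the orthonormal frame `e₁ = ∇f/|∇f|`
(Chern 1944, §1–§2), in the form `K = div(∇_{e₁} e₁ − (div e₁) e₁)` written with functions only
(so that Green's identity integrates it): `∇_{e₁}e₁ − (div e₁)e₁ = (½∇u − L∇f)/u`.

The identity is local and tensorial, so it is proved in the chart at the point: by the tree's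
bridges (`gradSq_chartInv_eq`, `innerDual_chartInv_eq`, `dalembertian_chartInv_eq`,
`scalarCurvature_comap` with `OpensChart.scalarCurvature_eq_scalAt`) every term is the
corresponding coordinate object of the chart components `G = chartRep g`, for which the identity
is `MetricCoord.half_scalAt_mul_gradSqAt_sq` (`CoordSurfaceBochner.lean`: Bochner's formula,
`Ric = ½ S g` on surfaces and a Cayley–Hamilton identity). Everything is proved; no definitions,
no named facts.

## References

* S.-S. Chern, *A simple intrinsic proof of the Gauss–Bonnet formula for closed Riemannian
  manifolds*, Ann. of Math. 45 (1944) 747–752, §1–§2. [Chern1944]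
* P. Topping, *Lectures on the Ricci flow*, CUP 2006, proof of Prop. 8.2.6 (Bochner formula).
  [Topping2006]
* B. O'Neill, *Semi-Riemannian geometry* (1983), Ch. 3, Prop. 3.59 (local isometries preserve
  curvature, the connection and hence `Δ`). [ONeill1983]
-/

noncomputable section

open Bundle Set Function Filter Module TopologicalSpace
open scoped Manifold ContDiff Topology

namespace Literature.Geometry.Lorentzian

open Literature.Geometry.Riemannian PseudoRiemannianMetric

variable {E : Type*} [NormedAddCommGroup E] [NormedSpace ℝ E] [FiniteDimensional ℝ E]
  [CompleteSpace E] {H : Type*} [TopologicalSpace H] {I : ModelWithCorners ℝ E H} [I.Boundaryless]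
  {M : Type*} [TopologicalSpace M] [ChartedSpace H M] [IsManifold I ∞ M]
  (g : PseudoRiemannianMetric I ∞ E (TangentSpace I : M → Type _)) [g.HasLeviCivita]

/-! ### Reading the scalar curvature and the representatives in the chart -/

/-- **The scalar curvature read in the chart**: `S_g(Φ u) = scalAt G u` for the chart components
`G = chartRep g` and the inverse extended chart `Φ = chartInv` (`scalarCurvature_comap`,
`OpensChart.scalarCurvature_eq_scalAt`). [cite: ONeill1983, Ch. 3, Prop. 3.59] -/
theorem scalarCurvature_chartInv_eq (x₀ : M) (u : chartTarget I x₀) :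
    g.scalarCurvature (chartInv I x₀ u) =
      MetricCoord.scalAt (chartRep I (fun _ ↦ g) x₀ 0) u := by
  haveI := (chartPullback I g x₀).hasLeviCivita
  rw [← OpensChart.scalarCurvature_eq_scalAt (val_chartPullback_eq_chartRep (fun _ ↦ g) x₀ 0) u,
    g.scalarCurvature_comap contMDiff_pullbackBilin_holds (contMDiff_chartInv x₀)
      (injective_mfderiv_chartInv x₀) rfl u]

omit [CompleteSpace E] [g.HasLeviCivita] in
/-- The representative of `|∇F|²` agrees near every point of the chart target with the
coordinate gradient square of the representative of `F`. [folklore] -/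
theorem gradSq_comp_symm_eventuallyEq (x₀ : M) (u : chartTarget I x₀) {F : M → ℝ}
    (hF : ContMDiff I 𝓘(ℝ, ℝ) ∞ F) :
    (g.gradSq F ∘ (extChartAt I x₀).symm) =ᶠ[𝓝 (u : E)]
      MetricCoord.gradSqAt (chartRep I (fun _ ↦ g) x₀ 0) (F ∘ (extChartAt I x₀).symm) := by
  filter_upwards [(isOpen_extChartAt_target x₀).mem_nhds u.2] with y hy
  have h := gradSq_chartInv_eq g x₀ ⟨y, hy⟩ (F := F)
    ((hF _).mdifferentiableAt (by simp))
  exact h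

omit [CompleteSpace E] in
/-- The representative of `Δ F` agrees near every point of the chart target with the coordinate
Laplacian of the representative of `F`. [folklore] -/
theorem dalembertian_comp_symm_eventuallyEq (x₀ : M) (u : chartTarget I x₀) {F : M → ℝ}
    (hF : ContMDiff I 𝓘(ℝ, ℝ) ∞ F) :
    (g.dalembertian F ∘ (extChartAt I x₀).symm) =ᶠ[𝓝 (u : E)]
      MetricCoord.lapAt (chartRep I (fun _ ↦ g) x₀ 0) (F ∘ (extChartAt I x₀).symm) := by
  filter_upwards [(isOpen_extChartAt_target x₀).mem_nhds u.2] with y hy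
  have h := dalembertian_chartInv_eq g x₀ ⟨y, hy⟩ (F := F)
    ((hF _).of_le (WithTop.coe_le_coe.mpr le_top))
  exact h

/-! ### The identity -/

/-- **The transgression identity at a point of a chart.** [cite: Chern1944, §1–§2] -/
theorem half_scalarCurvature_mul_gradSq_sq_chartInv (hg : g.IsRiemannian)
    (h2 : finrank ℝ E = 2) {f : M → ℝ} (hf : ContMDiff I 𝓘(ℝ, ℝ) ∞ f) (x₀ : M)
    (u : chartTarget I x₀) :
    g.scalarCurvature (chartInv I x₀ u) / 2 * g.gradSq f (chartInv I x₀ u) ^ 2 =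
      2⁻¹ * g.gradSq f (chartInv I x₀ u) * g.dalembertian (g.gradSq f) (chartInv I x₀ u)
        - 2⁻¹ * g.gradSq (g.gradSq f) (chartInv I x₀ u)
        - g.gradSq f (chartInv I x₀ u) *
            g.innerDual (chartInv I x₀ u)
              (mvfderiv I (g.dalembertian f) (chartInv I x₀ u) :
                TangentSpace I (chartInv I x₀ u) →ₗ[ℝ] ℝ)
              (mvfderiv I f (chartInv I x₀ u) : TangentSpace I (chartInv I x₀ u) →ₗ[ℝ] ℝ)
        + g.dalembertian f (chartInv I x₀ u) *
            g.innerDual (chartInv I x₀ u)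
              (mvfderiv I (g.gradSq f) (chartInv I x₀ u) :
                TangentSpace I (chartInv I x₀ u) →ₗ[ℝ] ℝ)
              (mvfderiv I f (chartInv I x₀ u) : TangentSpace I (chartInv I x₀ u) →ₗ[ℝ] ℝ)
        - g.dalembertian f (chartInv I x₀ u) ^ 2 * g.gradSq f (chartInv I x₀ u) := by
  set G := chartRep I (fun _ ↦ g) x₀ 0 with hGdef
  set fr : E → ℝ := f ∘ (extChartAt I x₀).symm with hfr
  have hG := val_chartPullback_eq_chartRep (fun _ : ℝ ↦ g) x₀ 0
  have hGm : MetricCoord.IsMetricOn G (extChartAt I x₀).target := OpensChart.isMetricOn_repr hG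
  have hu : (u : E) ∈ (extChartAt I x₀).target := u.2
  -- smoothness of the functions involved
  have hgs : ContMDiff I 𝓘(ℝ, ℝ) ∞ (g.gradSq f) := contMDiff_gradSq g hf
  have hL : ContMDiff I 𝓘(ℝ, ℝ) ∞ (g.dalembertian f) := contMDiff_dalembertian g hf
  have hfm : MDifferentiableAt I 𝓘(ℝ, ℝ) f (chartInv I x₀ u) := (hf _).mdifferentiableAt (by simp)
  have hgsm : MDifferentiableAt I 𝓘(ℝ, ℝ) (g.gradSq f) (chartInv I x₀ u) :=
    (hgs _).mdifferentiableAt (by simp)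
  have hLm : MDifferentiableAt I 𝓘(ℝ, ℝ) (g.dalembertian f) (chartInv I x₀ u) :=
    (hL _).mdifferentiableAt (by simp)
  have hfr_smooth : ContDiffOn ℝ ∞ fr (extChartAt I x₀).target := by
    rw [hfr, ← contMDiffOn_iff_contDiffOn]
    exact hf.comp_contMDiffOn (contMDiffOn_extChartAt_symm x₀)
  -- positivity and dimension
  have hpos : ∀ v, v ≠ 0 → 0 < G u v v := fun v hv ↦ by
    have h := chartPullback_pos g x₀ u (fun w hw ↦ hg _ w hw) v hv
    rwa [hG u] at h
  -- the representatives near `u`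
  have hgs_ev := gradSq_comp_symm_eventuallyEq g x₀ u hf
  have hL_ev := dalembertian_comp_symm_eventuallyEq g x₀ u hf
  -- each term read in the chart
  have hS : g.scalarCurvature (chartInv I x₀ u) = MetricCoord.scalAt G u :=
    scalarCurvature_chartInv_eq g x₀ u
  have h_u : g.gradSq f (chartInv I x₀ u) = MetricCoord.gradSqAt G fr u := gradSq_chartInv_eq g x₀ u hfm
  have h_L : g.dalembertian f (chartInv I x₀ u) = MetricCoord.lapAt G fr u :=
    dalembertian_chartInv_eq g x₀ u ((hf _).of_le (WithTop.coe_le_coe.mpr le_top))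
  have h_Lu : g.dalembertian (g.gradSq f) (chartInv I x₀ u) =
      MetricCoord.lapAt G (MetricCoord.gradSqAt G fr) u := by
    rw [dalembertian_chartInv_eq g x₀ u ((hgs _).of_le (WithTop.coe_le_coe.mpr le_top))]
    exact MetricCoord.lapAt_congr_of_eventuallyEq G hgs_ev
  have h_uu : g.gradSq (g.gradSq f) (chartInv I x₀ u) =
      fderiv ℝ (MetricCoord.gradSqAt G fr) u
        (MetricCoord.sharpAt G u (fderiv ℝ (MetricCoord.gradSqAt G fr) u)) := by
    rw [gradSq_chartInv_eq g x₀ u hgsm, MetricCoord.gradSqAt_apply, hgs_ev.fderiv_eq]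
  have h_Lf : g.innerDual (chartInv I x₀ u)
      (mvfderiv I (g.dalembertian f) (chartInv I x₀ u) : TangentSpace I (chartInv I x₀ u) →ₗ[ℝ] ℝ)
      (mvfderiv I f (chartInv I x₀ u) : TangentSpace I (chartInv I x₀ u) →ₗ[ℝ] ℝ) =
      fderiv ℝ (MetricCoord.lapAt G fr) u (MetricCoord.sharpAt G u (fderiv ℝ fr u)) := by
    rw [innerDual_chartInv_eq g x₀ u hLm hfm, hL_ev.fderiv_eq]
  have h_uf : g.innerDual (chartInv I x₀ u)
      (mvfderiv I (g.gradSq f) (chartInv I x₀ u) : TangentSpace I (chartInv I x₀ u) →ₗ[ℝ] ℝ)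
      (mvfderiv I f (chartInv I x₀ u) : TangentSpace I (chartInv I x₀ u) →ₗ[ℝ] ℝ) =
      fderiv ℝ (MetricCoord.gradSqAt G fr) u (MetricCoord.sharpAt G u (fderiv ℝ fr u)) := by
    rw [innerDual_chartInv_eq g x₀ u hgsm hfm, hgs_ev.fderiv_eq]
  rw [hS, h_u, h_L, h_Lu, h_uu, h_Lf, h_uf]
  exact MetricCoord.half_scalAt_mul_gradSqAt_sq hGm hu hpos h2 hfr_smooth

/-- **The transgression identity of the Gauss–Bonnet integrand.** On a smooth Riemannian surface
`(M, g)` (`dim = 2`), for `f : M → ℝ` smooth, with `u = |∇f|²_g`, `L = Δ_g f`,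
`⟨·,·⟩ = g⁻¹(·,·)` on differentials and `S` the scalar curvature, at every point `x`:

  `½ S(x) u(x)² = ½ u Δu − ½ ⟨du, du⟩ − u ⟨dL, df⟩ + L ⟨du, df⟩ − L² u`.

On `{df ≠ 0}` this is `K = div((½∇u − L∇f)/u) = div(∇_{e₁}e₁ − (div e₁)e₁)`, `e₁ = ∇f/|∇f|`,
i.e. the exactness `K dA = dω₁₂` of the curvature form of a surface along an orthonormal frame
(Chern 1944, §1–§2, the pointwise step of the intrinsic proof of the Gauss–Bonnet formula),
multiplied by `u²`; it holds trivially-compatibly at critical points as well. Proof: in the chart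
at `x` (`half_scalarCurvature_mul_gradSq_sq_chartInv`, from
`MetricCoord.half_scalAt_mul_gradSqAt_sq`). [cite: Chern1944, §1–§2]
[cite: Topping2006, proof of Prop. 8.2.6 (Bochner formula)] -/
theorem half_scalarCurvature_mul_gradSq_sq (hg : g.IsRiemannian) (h2 : finrank ℝ E = 2)
    {f : M → ℝ} (hf : ContMDiff I 𝓘(ℝ, ℝ) ∞ f) (x : M) :
    g.scalarCurvature x / 2 * g.gradSq f x ^ 2 =
      2⁻¹ * g.gradSq f x * g.dalembertian (g.gradSq f) x
        - 2⁻¹ * g.gradSq (g.gradSq f) x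
        - g.gradSq f x *
            g.innerDual x (mvfderiv I (g.dalembertian f) x : TangentSpace I x →ₗ[ℝ] ℝ)
              (mvfderiv I f x : TangentSpace I x →ₗ[ℝ] ℝ)
        + g.dalembertian f x *
            g.innerDual x (mvfderiv I (g.gradSq f) x : TangentSpace I x →ₗ[ℝ] ℝ)
              (mvfderiv I f x : TangentSpace I x →ₗ[ℝ] ℝ)
        - g.dalembertian f x ^ 2 * g.gradSq f x := by
  have hx : x ∈ (chartAt H x).source := mem_chart_source H x
  have h := half_scalarCurvature_mul_gradSq_sq_chartInv g hg h2 hf x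
    ⟨extChartAt I x x, (extChartAt I x).map_source (by rwa [extChartAt_source])⟩
  rwa [chartInv_extChartAt x hx] at h

end Literature.Geometry.Lorentzian

end
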